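import Summits.Langlands.Langlands.Theorems.QuadraticWindowHostInducedRepInducedCharpolyBlocks
import Literature.NumberTheory.Automorphic.AshSmithTheoryHeckeFrobeniusProofs
import HarnessLib

/-!
# The Frobenius characteristic polynomial of an induced Galois representation in every rank —
helper (2/2) for stub `stub_totallyRealInduction` of line `one-transparent-pane`
(crux `Summit.Langlands.Langlands.Theses.QuadraticWindow.HostInducedRep`, item stmt-Langlands-10902)

Sorry-free, no definitions.  The tree's `FramedGaloisRep.exists_charpoly_induce_eq_prod`
(`AshSmithTheoryHeckeFrobeniusProofs`, Ash 2003 Lemma 4.2) computes the Frobenius characteristic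
polynomial of `Ind_{Γ_F}^{Γ_K} ρ` for a CHARACTER `ρ`; here the same is done for `ρ` of any rank `m`:

* `charpoly_comp_indMatrix_eq_prod`: for `φ : H →* G` injective with normal image of finite index,
  `π : H →* M_n(B)`, a transversal `r` of `G / φ(H)`, `g ∈ G` with `ḡ` of order `f`, representatives
  `τ_k` of `⟨g⟩ \ G / φ(H)` and `φ(s_k) = τ_k⁻¹ g^f τ_k`:
  `det(X - Ind(π)(g)) = ∏_k det(X^f - π(s_k)) = ∏_k expand f (charpoly π(s_k))` — the proof of the
  character case verbatim (in the transversal `g^t τ_k` the matrix is block diagonal with one block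
  cyclic shift `S_f(π(s_k))` per double coset; `charpoly_cycShift` of the companion file 1/2).
* `exists_charpoly_induce_eq_prod_expand`: for `F/K` finite Galois of degree `d`, `ρ : Γ_F → GL_m(A)`,
  `𝔓 ∣ v` with `I_𝔓 ≤ res(Γ_F)` and an arithmetic Frobenius `σ` at `𝔓`, there are arithmetic
  Frobenii `s_w ∈ Γ_F` above the places `w ∣ v` with
  `det(X - Ind(ρ)(σ)) = ∏_{w ∣ v} expand_{f(w|v)} det(X - ρ(s_w))` — the double-coset bookkeeping
  (`⟨σ⟩ \ Γ_K / Γ_F ↔ {w ∣ v}`, Neukirch VII §10) copied line by line from the rank-one proof.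

Companion: `QuadraticWindowHostInducedRepTotallyRealInduction.lean` (quadratic induction of
Frobenius packages, `HasQuadraticInduction` in every rank, and the stub).

References: A. Ash, *Smith theory and Hecke operators*, J. Algebra 259 (2003), Lemma 4.2 [Ash2003];
J. Neukirch, *Algebraic Number Theory* (1999), I §9, VII §10, proof of (10.4) (iv) [NeukirchANT1999];
J.-P. Serre, *Linear representations of finite groups*, GTM 42 (1977), §3.3, §7.3
[SerreLinearRepresentations1977].
-/

set_option linter.dupNamespace false -- project-wide option (lakefile weak.linter.dupNamespace); `Summit.Langlands.Langlands` is the mandated namespace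

noncomputable section

open Polynomial

namespace Summit.Langlands.Langlands.Theorems.HostInducedRep.OneTransparentPane

/-! ### Characteristic polynomials of `Ind(π)(g)` for a matrix-valued `π` -/

section Induced

variable {H G : Type*} [Group H] [Group G] {B : Type*} [CommRing B] {n : ℕ}

/-- **The characteristic polynomial of `Ind(π)(g)` for a matrix-valued `π`.**  Let `φ : H →* G` be
injective with normal image, `π : H →* M_n(B)` a homomorphism into `n × n` matrices over a
commutative ring `B`, `r : ι → G` a (finite) transversal of `G / φ(H)`, `g ∈ G`, and `f` the order
of `ḡ` in `G / φ(H)`.  Let `τ : κ → G` represent the double cosets `⟨g⟩ \ G / φ(H)` (`hcov`,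
`hdisj`) and `φ(s_k) = τ_k⁻¹ g^f τ_k`.  Then
`det(X - Ind(π)(g)) = ∏_k det(X^f - π(s_k)) = ∏_k expand f (charpoly π(s_k))`.
Proof: as for characters (`Ash2003.charpoly_indMatrix_eq_prod`): in the transversal `g^t τ_k`
(`0 ≤ t < f`) the matrix `Ind(π)(g)` is block diagonal with one block cyclic shift `S_f(π(s_k))`
per double coset (`charpoly_comp_blockDiagonal`, `charpoly_cycShift`).
Ref: Serre, *Linear representations of finite groups*, §3.3, §7.3 Prop. 22; Neukirch, *Algebraic
Number Theory*, VII §10, proof of (10.4) (iv). [folklore] -/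
theorem charpoly_comp_indMatrix_eq_prod {φ : H →* G} (hφ : Function.Injective φ)
    [hN : φ.range.Normal] (π : H →* Matrix (Fin n) (Fin n) B) {ι : Type*} [Fintype ι]
    [DecidableEq ι] {r : ι → G} (hr : Function.Bijective fun i => (r i : G ⧸ φ.range)) (g : G)
    {κ : Type*} [Fintype κ] [DecidableEq κ] (τ : κ → G) (s : κ → H)
    (hcov : ∀ x : G, ∃ k, ∃ t : ℕ, ∃ a : H, x = g ^ t * τ k * φ a)
    (hdisj : ∀ (k k' : κ) (t : ℕ) (a : H), τ k' = g ^ t * τ k * φ a → k = k')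
    (hs : ∀ k, φ (s k) = (τ k)⁻¹ * g ^ orderOf (g : G ⧸ φ.range) * τ k) :
    (Matrix.comp ι ι (Fin n) (Fin n) B
        (Literature.NumberTheory.GaloisRepresentations.indMatrix φ π r g)).charpoly =
      ∏ k, expand B (orderOf (g : G ⧸ φ.range)) (π (s k)).charpoly := by
  -- adapted from Literature/NumberTheory/Automorphic/AshSmithTheoryHeckeCharpolyProofs.lean
  -- (`Ash2003.charpoly_indMatrix_eq_prod`, characters ↦ blocks)
  set f := orderOf (g : G ⧸ φ.range) with hfdef
  haveI : Finite (G ⧸ φ.range) := Finite.of_equiv ι (Equiv.ofBijective _ hr)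
  have hf : 0 < f := orderOf_pos _
  -- `g ^ t ∈ φ(H)` iff `f ∣ t`
  have hpow : ∀ t : ℕ, g ^ t ∈ φ.range ↔ f ∣ t := fun t => by
    rw [← QuotientGroup.eq_one_iff, QuotientGroup.mk_pow]
    exact ⟨fun h => orderOf_dvd_of_pow_eq_one h, fun h => orderOf_dvd_iff_pow_eq_one.mp h⟩
  have hconj : ∀ x y : G, x ∈ φ.range → y⁻¹ * x * y ∈ φ.range := fun x y hx => by
    simpa using hN.conj_mem x hx y⁻¹
  have hconj' : ∀ x y : G, y⁻¹ * x * y ∈ φ.range → x ∈ φ.range := fun x y hx => by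
    have := hN.conj_mem _ hx y
    simpa [mul_assoc] using this
  -- the transversal adapted to `g`
  set r' : Fin f × κ → G := fun tk => g ^ (tk.1 : ℕ) * τ tk.2 with hr'def
  have hr'a : ∀ (t : Fin f) (k : κ), r' (t, k) = g ^ (t : ℕ) * τ k := fun _ _ => rfl
  have key : ∀ (t t' : Fin f) (k k' : κ), (t : ℕ) ≤ t' →
      ((r' (t, k) : G ⧸ φ.range) = r' (t', k')) → (t, k) = (t', k') := by
    intro t t' k k' htt' heq
    rw [QuotientGroup.eq, hr'a, hr'a] at heq
    have h2 : g ^ (t' : ℕ) = g ^ (t : ℕ) * g ^ ((t' : ℕ) - t) := by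
      rw [← pow_add, Nat.add_sub_cancel' htt']
    have h1 : (g ^ (t : ℕ) * τ k)⁻¹ * (g ^ (t' : ℕ) * τ k') =
        (τ k)⁻¹ * g ^ ((t' : ℕ) - t) * τ k' := by
      rw [h2]; group
    rw [h1] at heq
    obtain ⟨a, ha⟩ := heq
    have hkk : k' = k := by
      refine hdisj k' k ((t' : ℕ) - t) a⁻¹ ?_
      rw [map_inv, ha]; group
    subst hkk
    have hmem : g ^ ((t' : ℕ) - t) ∈ φ.range := hconj' _ (τ k') ⟨a, ha⟩
    have h0 : (t' : ℕ) - t = 0 :=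
      Nat.eq_zero_of_dvd_of_lt ((hpow _).mp hmem) (by have := t'.2; omega)
    have : t = t' := Fin.ext (by omega)
    rw [this]
  have hr'inj : Function.Injective fun tk : Fin f × κ => (r' tk : G ⧸ φ.range) := by
    rintro ⟨t, k⟩ ⟨t', k'⟩ heq
    rcases le_total (t : ℕ) t' with h | h
    · exact key _ _ _ _ h heq
    · exact (key _ _ _ _ h heq.symm).symm
  have hr'surj : Function.Surjective fun tk : Fin f × κ => (r' tk : G ⧸ φ.range) := by
    intro q
    induction q using QuotientGroup.induction_on with
    | H x =>
      obtain ⟨k, t, a, rfl⟩ := hcov x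
      refine ⟨(⟨t % f, Nat.mod_lt _ hf⟩, k), ?_⟩
      change (r' _ : G ⧸ φ.range) = _
      rw [QuotientGroup.eq, hr'a]
      have hgt : g ^ t = g ^ (t % f) * g ^ (f * (t / f)) := by
        rw [← pow_add, Nat.mod_add_div]
      have hx : (g ^ (t % f) * τ k)⁻¹ * (g ^ t * τ k * φ a) =
          ((τ k)⁻¹ * g ^ (f * (t / f)) * τ k) * φ a := by
        rw [hgt]
        group
      rw [hx]
      exact φ.range.mul_mem (hconj _ _ ((hpow _).mpr (dvd_mul_right f _))) ⟨a, rfl⟩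
  have hr' : Function.Bijective fun tk : Fin f × κ => (r' tk : G ⧸ φ.range) := ⟨hr'inj, hr'surj⟩
  rw [← charpoly_comp_indMatrix_eq_of_transversal hφ π hr hr' g]
  -- block form of `Ind(π)(g)` in the adapted transversal: one block cyclic shift per double coset
  have hblock : Literature.NumberTheory.GaloisRepresentations.indMatrix φ π r' g =
      Matrix.blockDiagonal fun k => Matrix.of fun (i : Fin f) (j : Fin f) =>
        if (i : ℕ) = (j : ℕ) + 1 then (1 : Matrix (Fin n) (Fin n) B)
        else if (j : ℕ) + 1 = f ∧ (i : ℕ) = 0 then π (s k) else 0 := by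
    ext ⟨t, k⟩ ⟨t', k'⟩ : 2
    rw [Literature.NumberTheory.GaloisRepresentations.indMatrix_apply, Matrix.blockDiagonal_apply,
      Matrix.of_apply]
    dsimp only
    by_cases hlt : (t' : ℕ) + 1 < f
    · -- `g · r'(t', k') = r'(t' + 1, k')`
      have h1 : (r' (t, k))⁻¹ * g * r' (t', k') = (r' (t, k))⁻¹ * r' (⟨(t' : ℕ) + 1, hlt⟩, k') := by
        simp only [hr'a, pow_succ]
        group
      rw [h1, Literature.NumberTheory.Automorphic.Ash2003.dotExtend_inv_mul_eq_ite hφ π hr'.1]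
      by_cases hk : k = k'
      · subst hk
        have hne : ¬ ((t' : ℕ) + 1 = f ∧ (t : ℕ) = 0) := fun h => absurd h.1 hlt.ne
        rw [if_neg hne, if_pos rfl]
        by_cases ht : (t : ℕ) = t' + 1
        · rw [if_pos ht, if_pos (show (t, k) = (⟨(t' : ℕ) + 1, hlt⟩, k) from
            Prod.ext (Fin.ext ht) rfl)]
        · rw [if_neg ht, if_neg (show ¬ (t, k) = (⟨(t' : ℕ) + 1, hlt⟩, k) from
            fun h => ht (congrArg Fin.val (Prod.mk.inj h).1))]
      · rw [if_neg (show ¬ (t, k) = (⟨(t' : ℕ) + 1, hlt⟩, k') from fun h => hk (Prod.mk.inj h).2),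
          if_neg hk]
    · have heq : (t' : ℕ) + 1 = f := le_antisymm t'.2 (not_lt.mp hlt)
      -- `g · r'(t', k') = r'(0, k') · φ(s k')`
      have h1 : (r' (t, k))⁻¹ * g * r' (t', k') =
          (r' (t, k))⁻¹ * r' (⟨0, hf⟩, k') * φ (s k') := by
        have hgf : g ^ f = g ^ (t' : ℕ) * g := by rw [← pow_succ, heq]
        rw [hs k', hgf]
        simp only [hr'a, pow_zero, one_mul]
        group
      rw [h1, Literature.NumberTheory.GaloisRepresentations.dotExtend_mul_map hφ,
        Literature.NumberTheory.Automorphic.Ash2003.dotExtend_inv_mul_eq_ite hφ π hr'.1]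
      by_cases hk : k = k'
      · subst hk
        have ht : ¬ ((t : ℕ) = t' + 1) := by have := t.2; omega
        rw [if_neg ht, if_pos rfl]
        by_cases ht0 : (t : ℕ) = 0
        · rw [if_pos (show (t, k) = (⟨0, hf⟩, k) from Prod.ext (Fin.ext ht0) rfl), one_mul,
            if_pos ⟨heq, ht0⟩]
        · rw [if_neg (show ¬ (t, k) = (⟨0, hf⟩, k) from
              fun h => ht0 (congrArg Fin.val (Prod.mk.inj h).1)), zero_mul,
            if_neg (fun h => ht0 h.2)]
      · rw [if_neg (show ¬ (t, k) = (⟨0, hf⟩, k') from fun h => hk (Prod.mk.inj h).2), zero_mul,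
          if_neg hk]
  rw [hblock, charpoly_comp_blockDiagonal]
  exact Finset.prod_congr rfl fun k _ => charpoly_cycShift hf _

end Induced

/-! ### The Frobenius characteristic polynomial of `Ind_{Γ_F}^{Γ_K} ρ` in every rank -/

section Galois

open scoped NumberField Pointwise
open IsDedekindDomain Field Literature.NumberTheory.GaloisRepresentations

universe u v

variable (K : Type u) {F : Type v} [Field K] [NumberField K] [Field F] [NumberField F] [Algebra K F]
  [FiniteDimensional K F] [IsGalois K F] {A : Type*} [CommRing A] [TopologicalSpace A] {d m : ℕ}

-- One long proof with many local definitions (`set`/`choose`); as in the rank-one original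
-- `FramedGaloisRep.exists_charpoly_induce_eq_prod`, the default limits are slightly too small for
-- the elaboration of the double-coset bookkeeping (pointwise `Γ_K`-action on ideals of `\bar ℤ_K`).
set_option maxHeartbeats 400000 in
set_option synthInstance.maxHeartbeats 80000 in
/-- **Frobenius characteristic polynomial of `Ind_{Γ_F}^{Γ_K} ρ` in rank `m`, unramified case.**
Let `F/K` be a finite Galois extension of number fields of degree `d`, `ρ : Γ_F → GL_m(A)` a framed
representation over a commutative ring `A`, `v` a finite place of `K`, `𝔓 ∣ v` a prime of `\bar ℤ_K`
with `I_𝔓 ≤ res(Γ_F)` (`v` unramified in `F`) and `σ ∈ Γ_K` an arithmetic Frobenius at `𝔓`.  Then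
there are primes `𝔔_w ∣ w` of `\bar ℤ_F` and arithmetic Frobenii `s_w ∈ Γ_F` at `𝔔_w`, one for each
place `w ∣ v` of `F`, with
`det(X - Ind(ρ)(σ)) = ∏_{w ∣ v} det(X^{f(w|v)} - ρ(s_w)) = ∏_{w ∣ v} expand_{f(w|v)} (charpoly ρ(s_w))`.
This is the rank-`m` version of the tree's `FramedGaloisRep.exists_charpoly_induce_eq_prod`
(rank one, Ash 2003 Lemma 4.2), with the same proof: the group theory is
`charpoly_comp_indMatrix_eq_prod`, and the matching of the double cosets `⟨σ⟩ \ Γ_K / Γ_F` with the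
places `w ∣ v` (Neukirch VII §10, proof of (10.4) (iv)) is copied line by line from that proof.
Ref: Neukirch, *Algebraic Number Theory*, VII §10, proof of (10.4) (iv); Serre, *Linear
representations of finite groups*, §3.3, §7.3. [folklore] -/
theorem exists_charpoly_induce_eq_prod_expand (hd : Module.finrank K F = d)
    (ρ : FramedGaloisRep F A m) {v : HeightOneSpectrum (𝓞 K)} {𝔓 : Ideal (absIntegers (𝓞 K) K)}
    (h𝔓 : 𝔓 ∈ v.primesAbove)
    (hI : 𝔓.inertia (absoluteGaloisGroup K) ≤ (absGaloisRestrict K F).toMonoidHom.range)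
    {σ : absoluteGaloisGroup K} (hσ : IsArithFrobAt (𝓞 K) σ 𝔓)
    [Fintype {w : HeightOneSpectrum (𝓞 F) // w.under (𝓞 K) = v}] :
    ∃ (𝔔 : {w : HeightOneSpectrum (𝓞 F) // w.under (𝓞 K) = v} → Ideal (absIntegers (𝓞 F) F))
      (s : {w : HeightOneSpectrum (𝓞 F) // w.under (𝓞 K) = v} → absoluteGaloisGroup F),
      (∀ w, 𝔔 w ∈ w.1.primesAbove ∧ IsArithFrobAt (𝓞 F) (s w) (𝔔 w)) ∧
        FramedRep.charpoly (ρ.induce K hd) σ =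
          ∏ w, expand A (w.1.asIdeal.inertiaDeg (𝓞 K)) (FramedRep.charpoly ρ (s w)) := by
  -- adapted from Literature/NumberTheory/Automorphic/AshSmithTheoryHeckeFrobeniusProofs.lean
  -- (`FramedGaloisRep.exists_charpoly_induce_eq_prod`, rank one ↦ rank `m`; Steps B–C verbatim)
  classical
  set res := absGaloisRestrict K F with hres
  set φ : absoluteGaloisGroup F →* absoluteGaloisGroup K := res.toMonoidHom with hφdef
  have hφa : ∀ γ, φ γ = res γ := fun _ => rfl
  have hinj : Function.Injective φ := absGaloisRestrict_injective K F
  haveI hNormal : φ.range.Normal := normal_range_absGaloisRestrict K F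
  set r := absGaloisCosetRep K F hd
  have hr := absGaloisCosetRep_bijective K F hd
  -- Step A: `det(X - Ind(ρ)(σ))` is the characteristic polynomial of the flattened block matrix
  have hA : FramedRep.charpoly (ρ.induce K hd) σ =
      (Matrix.comp (Fin d) (Fin d) (Fin m) (Fin m) A
        (indMatrix φ (FramedRep.toMatrixHom ρ) r σ)).charpoly := by
    change ((ρ.induce K hd σ : GL (Fin (d * m)) A) : Matrix (Fin (d * m)) (Fin (d * m)) A).charpoly = _
    rw [FramedGaloisRep.induce_def, FramedRep.induce_apply_coe, FramedRep.indFlatHom_apply_eq_reindex,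
      Matrix.charpoly_reindex]
  -- Step B: the places `w ∣ v`, primes `𝔔_w ∣ w` of `\bar ℤ_F`, and `τ_w ∈ Γ_K` with
  -- `ι⁻¹ 𝔔_w = τ_w⁻¹ 𝔓`
  have hwv : ∀ w : {w : HeightOneSpectrum (𝓞 F) // w.under (𝓞 K) = v},
      w.1.asIdeal.under (𝓞 K) = v.asIdeal := fun w => congrArg HeightOneSpectrum.asIdeal w.2
  set ι := absIntegersMap K F with hι
  haveI h𝔓p : 𝔓.IsPrime := h𝔓.1
  have hdata : ∀ w : {w : HeightOneSpectrum (𝓞 F) // w.under (𝓞 K) = v},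
      ∃ 𝔔 : Ideal (absIntegers (𝓞 F) F), ∃ τ : absoluteGaloisGroup K,
        𝔔 ∈ w.1.primesAbove ∧ τ • 𝔔.comap ι = 𝔓 := by
    intro w
    obtain ⟨𝔔, h𝔔⟩ := w.1.primesAbove_nonempty
    obtain ⟨τ, hτ⟩ := HeightOneSpectrum.exists_smul_eq_of_mem_primesAbove_holds
      (comap_absIntegersMap_mem_primesAbove (hwv w) h𝔔) h𝔓
    exact ⟨𝔔, τ, h𝔔, hτ⟩
  choose 𝔔 τ h𝔔 hτ using hdata
  have h𝔔p : ∀ w, (𝔔 w).IsPrime := fun w => (h𝔔 w).1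
  have hcomap : ∀ w, (𝔔 w).comap ι = (τ w)⁻¹ • 𝔓 := fun w => by
    rw [← hτ w, inv_smul_smul]
  have hunder : ∀ w, (𝔔 w).under (𝓞 F) = w.1.asIdeal := fun w => (h𝔔 w).2.over.symm
  -- `σ ^ f ∈ Γ_F` and the elements `s_w`
  have hσf : σ ^ orderOf (σ : absoluteGaloisGroup K ⧸ φ.range) ∈ φ.range := by
    rw [← QuotientGroup.eq_one_iff, QuotientGroup.mk_pow]
    exact pow_orderOf_eq_one _
  have hsex : ∀ w : {w : HeightOneSpectrum (𝓞 F) // w.under (𝓞 K) = v},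
      ∃ s : absoluteGaloisGroup F,
        φ s = (τ w)⁻¹ * σ ^ orderOf (σ : absoluteGaloisGroup K ⧸ φ.range) * τ w := fun w => by
    have := hNormal.conj_mem _ hσf (τ w)⁻¹
    rw [inv_inv] at this
    exact this
  choose s hs using hsex
  -- `σ ∈ D_𝔓`, `Γ_F` open
  set D := 𝔓.decompositionSubgroup (absoluteGaloisGroup K) with hD
  have hσD : σ ∈ D := hσ.mem_stabilizer
  have hopen : IsOpen (φ.range : Set (absoluteGaloisGroup K)) := by
    rw [MonoidHom.coe_range]
    exact isOpen_range_absGaloisRestrict K F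
  -- Step B1: every `x ∈ Γ_K` lies in some `σ^t τ_w Γ_F`
  have hcov : ∀ x : absoluteGaloisGroup K, ∃ w, ∃ t : ℕ, ∃ a : absoluteGaloisGroup F,
      x = σ ^ t * τ w * φ a := by
    intro x
    have h𝔓x : x⁻¹ • 𝔓 ∈ v.primesAbove := smul_mem_primesAbove h𝔓 x⁻¹
    set 𝔔x : Ideal (absIntegers (𝓞 F) F) :=
      (x⁻¹ • 𝔓).comap ((absIntegersEquiv K F).symm : absIntegers (𝓞 F) F →+* absIntegers (𝓞 K) K)
      with h𝔔x
    have h𝔔xc : 𝔔x.comap ι = x⁻¹ • 𝔓 := by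
      rw [h𝔔x, hι, ← coe_absIntegersEquiv]
      exact Ideal.comap_of_equiv _
    haveI : 𝔔x.IsPrime := by
      haveI := h𝔓x.1
      exact Ideal.comap_isPrime _ _
    have h𝔔xv : 𝔔x.comap (absIntegersMap K F) ∈ v.primesAbove := by
      rw [← hι, h𝔔xc]
      exact h𝔓x
    obtain ⟨w₀, hw₀, h𝔔xw, -⟩ :=
      exists_heightOneSpectrum_of_comap_absIntegersMap_mem_primesAbove h𝔔xv
    let w : {w : HeightOneSpectrum (𝓞 F) // w.under (𝓞 K) = v} := ⟨w₀, HeightOneSpectrum.ext hw₀⟩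
    obtain ⟨γ, hγ⟩ := HeightOneSpectrum.exists_smul_eq_of_mem_primesAbove_holds h𝔔xw (h𝔔 w)
    have key : (φ γ * x⁻¹) • 𝔓 = (τ w)⁻¹ • 𝔓 := by
      rw [mul_smul, ← h𝔔xc, hφa, ← comap_absIntegersMap_smul, hγ, ← hι, hcomap w]
    have hd' : τ w * φ γ * x⁻¹ ∈ D := by
      rw [hD, Ideal.mem_decompositionSubgroup_iff, mul_assoc, mul_smul, key, smul_inv_smul]
    obtain ⟨n, i, u, hi, hu, heq⟩ :=
      exists_eq_frobenius_pow_mul_of_mem_decompositionSubgroup h𝔓 hσ hopen (D.inv_mem hd')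
    have hiu : i * u ∈ φ.range := φ.range.mul_mem (hI hi) hu
    have hconj : (τ w)⁻¹ * (i * u) * τ w * φ γ ∈ φ.range := by
      refine φ.range.mul_mem ?_ ⟨γ, rfl⟩
      have := hNormal.conj_mem _ hiu (τ w)⁻¹
      rwa [inv_inv] at this
    obtain ⟨a, ha⟩ := hconj
    refine ⟨w, n, a, ?_⟩
    rw [ha]
    calc x = (τ w * φ γ * x⁻¹)⁻¹ * τ w * φ γ := by group
      _ = σ ^ n * i * u * τ w * φ γ := by rw [heq]
      _ = σ ^ n * τ w * ((τ w)⁻¹ * (i * u) * τ w * φ γ) := by group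
  -- Step B2: distinct places give distinct double cosets
  have hdisj : ∀ (w w' : {w : HeightOneSpectrum (𝓞 F) // w.under (𝓞 K) = v}) (t : ℕ)
      (a : absoluteGaloisGroup F), τ w' = σ ^ t * τ w * φ a → w = w' := by
    intro w w' t a hEq
    have hd' : (σ ^ t)⁻¹ • 𝔓 = 𝔓 := by
      rw [inv_smul_eq_iff]
      exact (Ideal.mem_decompositionSubgroup_iff.mp (D.pow_mem hσD t)).symm
    have hij : (𝔔 w').comap ι = (a⁻¹ • 𝔔 w).comap ι := by
      rw [hι, comap_absIntegersMap_smul, ← hι, hcomap w, hcomap w', hEq, mul_inv_rev, mul_inv_rev,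
        mul_smul, mul_smul, hd', map_inv, hφa]
    have hQ : 𝔔 w' = a⁻¹ • 𝔔 w :=
      Ideal.comap_injective_of_surjective _ (absIntegersMap_surjective K F) hij
    apply Subtype.ext
    apply HeightOneSpectrum.ext
    rw [← hunder w, ← hunder w', hQ, under_smul_absIntegers]
  -- Step C: `f = f(w|v)` and `s_w` is a Frobenius at `𝔔_w`
  have hC : ∀ w : {w : HeightOneSpectrum (𝓞 F) // w.under (𝓞 K) = v},
      orderOf (σ : absoluteGaloisGroup K ⧸ φ.range) = w.1.asIdeal.inertiaDeg (𝓞 K) ∧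
        IsArithFrobAt (𝓞 F) (s w) (𝔔 w) := fun w =>
    Literature.NumberTheory.Automorphic.Ash2003.orderOf_frobenius_eq_inertiaDeg K F hNormal h𝔓 hI
      hσ (hwv w) (h𝔔 w) (hcomap w) (hs w)
  -- Step D: assemble
  refine ⟨𝔔, s, fun w => ⟨h𝔔 w, (hC w).2⟩, ?_⟩
  rw [hA, charpoly_comp_indMatrix_eq_prod hinj (FramedRep.toMatrixHom ρ) hr σ τ s hcov hdisj hs]
  exact Finset.prod_congr rfl fun w _ => by rw [(hC w).1, FramedRep.toMatrixHom_apply]; rfl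

end Galois

/-- **Registered anchor** of this helper file (stub registry of stmt-Langlands-10902, line
`one-transparent-pane`, chain `stub_totallyRealInduction` 2/3): the rank-`m` induced Frobenius
characteristic polynomial `exists_charpoly_induce_eq_prod_expand` at universe `0`. [folklore] -/
theorem inducedCharpoly_anchor : ∀ (K : Type) {F : Type} [Field K] [NumberField K] [Field F] [NumberField F] [Algebra K F] [FiniteDimensional K F] [IsGalois K F] {A : Type} [CommRing A] [TopologicalSpace A] {d m : ℕ} (hd : Module.finrank K F = d) (ρ : Literature.NumberTheory.GaloisRepresentations.FramedGaloisRep F A m) {v : IsDedekindDomain.HeightOneSpectrum (NumberField.RingOfIntegers K)} {𝔓 : Ideal (Literature.NumberTheory.GaloisRepresentations.absIntegers (NumberField.RingOfIntegers K) K)}, 𝔓 ∈ v.primesAbove → 𝔓.inertia (Field.absoluteGaloisGroup K) ≤ (Literature.NumberTheory.GaloisRepresentations.absGaloisRestrict K F).toMonoidHom.range → ∀ {σ : Field.absoluteGaloisGroup K}, IsArithFrobAt (NumberField.RingOfIntegers K) σ 𝔓 → ∀ [Fintype {w : IsDedekindDomain.HeightOneSpectrum (NumberField.RingOfIntegers F)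 // w.under (NumberField.RingOfIntegers K) = v}], ∃ (𝔔 : {w : IsDedekindDomain.HeightOneSpectrum (NumberField.RingOfIntegers F) // w.under (NumberField.RingOfIntegers K) = v} → Ideal (Literature.NumberTheory.GaloisRepresentations.absIntegers (NumberField.RingOfIntegers F) F)) (s : {w : IsDedekindDomain.HeightOneSpectrum (NumberField.RingOfIntegers F) // w.under (NumberField.RingOfIntegers K) = v} → Field.absoluteGaloisGroup F), (∀ w, 𝔔 w ∈ w.1.primesAbove ∧ IsArithFrobAt (NumberField.RingOfIntegers F) (s w) (𝔔 w)) ∧ Literature.NumberTheory.GaloisRepresentations.FramedRep.charpoly (ρ.induce K hd) σ = ∏ w, Polynomial.expand A (w.1.asIdeal.inertiaDeg (NumberField.RingOfIntegers K)) (Literature.NumberTheory.GaloisRepresentations.FramedRep.charpoly ρ (s w)) :=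
  fun K _ _ _ _ _ _ _ _ _ _ _ _ _ hd ρ _ _ h𝔓 hI _ hσ _ => exists_charpoly_induce_eq_prod_expand K hd ρ h𝔓 hI hσ

end Summit.Langlands.Langlands.Theorems.HostInducedRep.OneTransparentPane

end
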